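import Summits.BirchSwinnertonDyer.BirchSwinnertonDyer.Theorems.ErratumRoadFiveRest3DWitnessD1Visible
import Summits.BirchSwinnertonDyer.BirchSwinnertonDyer.Theorems.ErratumRoadFiveRest3DWitnessD2Visible
import Literature.NumberTheory.EllipticCurves.LocalEulerFactorModel
import Literature.NumberTheory.EllipticCurves.BSDConductorProofs
import Literature.NumberTheory.GaloisRepresentations.HeckeCharacterProofs
import HarnessLib

/-!
# Route `ErratumRoadFive` (rung K2), crux `RamNoErratumDataAtFive` (item stmt-BirchSwinnertonDyer-19624, REST‴), branch (D):
# the visible-`Ш` rungs at D1 and D2 with the SET OF BAD PLACES MADE EXPLICIT and good reduction outside it PROVED in the kernel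
# (cell `bsd-stepL`, owner seat `bsd-stepL-rest-p2` g5; `--supports stmt-BirchSwinnertonDyer-19624`; THEOREMS ONLY; Theses-FREE)

`ErratumRoadFiveRest3DWitnessD1Visible.lean` ∕ `…D2Visible.lean` (p538812 ∕ p541217) take the finite set `S` of places and the
hypothesis «outside `S` both curves have good reduction and `v ∤ 5`» (`hS`) as DATA. Here `S` is the kernel object
`{v₃, v₅, v₁₁, v₄₇, v₁₉₇}` (resp. `{v₂, v₃, v₅, v₁₉, v₁₂₇, v₃₅₉}`), `v_ℓ := primesEquiv.symm ℓ` the place of `ℚ` above `ℓ` (Mathlib `Rat.HeightOneSpectrum.primesEquiv`), written as Finset LITERALS (no new definition), and `hS` is a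
THEOREM: an integer model has good reduction at every place whose prime does not divide `Δ` (`v(aᵢ) ≤ 1`, `v(Δ) = 1`; Silverman AEC
VII.5 Prop. 5.1(a), tree `hasGoodReductionAt_of_valuation_le_one_of_valuation_Δ_eq_one`), and the prime factorisations
`Δ(D1) = 5³·11⁶·47·197⁶`, `Δ(V1) = −3¹⁰·5²·11¹¹·47·197⁶`, `Δ(D2) = −2⁶·5·127·359⁶`, `Δ(V2) = 2²³·3⁵·5²·19⁵·127³·359⁶` are kernel facts.
For D2 the paid place is the kernel object `v₁₉ ∈ S` with `5 ∉ v₁₉` proved. What remains DATA in the rungs below: `r_an = 1`,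
`#Ш_an`, the `Γ_ℚ`-isomorphism `θ`, the partner's rank, and the local KINDS at the five (six) explicit places (local 5-torsion counts,
multiplicative types, the `γ`-square at `v₅`). HONEST FRAMING: CONDITIONAL; per pair; nothing booked; no census word moves (T7).

References: [SilvermanAEC2009] VII.1, VII.5 Prop. 5.1(a), VIII.1 Rem. 1.3; [CremonaMazur2000] §3; [AgasheStein2002] Thm. 3.1;
[JetchevSkinnerWan2017] Thm. 3.3.1; [Miller2011LMS] Def. 1.1.
-/

-- the Theorems namespace of this sub repeats the summit name by design (D-0017 nested layout)
set_option linter.dupNamespace false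
set_option autoImplicit false

noncomputable section

open scoped Classical

open WeierstrassCurve IsDedekindDomain NumberField Rat.HeightOneSpectrum
  Literature.NumberTheory.EllipticCurves Literature.NumberTheory.EllipticCurves.Rank1Residual
  Literature.NumberTheory.EllipticCurves.Rank1Residual.Typed
  Summit.BirchSwinnertonDyer.Rank1Residual Summit.BirchSwinnertonDyer.Rank1Residual.X11b

namespace Summit.BirchSwinnertonDyer.BirchSwinnertonDyer.Theorems

namespace VisiblePlaces

/-! ## §1 Places of `ℚ` above a prime; good reduction of an integer model away from `Δ` -/

/-- The prime below the place `primesEquiv.symm p` is `p`. [folklore] -/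
theorem natGenerator_placeAbove (p : ℕ) (hp : p.Prime) : natGenerator ((primesEquiv (R := 𝓞 ℚ)).symm ⟨p, hp⟩) = p := by
  have h : primesEquiv (R := 𝓞 ℚ) ((primesEquiv (R := 𝓞 ℚ)).symm ⟨p, hp⟩) = ⟨p, hp⟩ := by
    rw [Equiv.apply_symm_apply]
  exact congrArg Subtype.val h

/-- A place whose prime is `p` IS `primesEquiv.symm p`. [folklore] -/
theorem eq_placeAbove_of_natGenerator_eq {v : HeightOneSpectrum (𝓞 ℚ)} {p : ℕ} (hp : p.Prime)
    (h : natGenerator v = p) : v = (primesEquiv (R := 𝓞 ℚ)).symm ⟨p, hp⟩ := by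
  apply (primesEquiv (R := 𝓞 ℚ)).injective
  rw [Equiv.apply_symm_apply]
  exact Subtype.ext h

/-- `(p : 𝓞 ℚ) ∈ v` iff `v` is the place above `p`. [folklore] -/
theorem natCast_mem_asIdeal_iff_eq_placeAbove (v : HeightOneSpectrum (𝓞 ℚ)) {p : ℕ} (hp : p.Prime) :
    (p : 𝓞 ℚ) ∈ v.asIdeal ↔ v = (primesEquiv (R := 𝓞 ℚ)).symm ⟨p, hp⟩ :=
  natCast_mem_asIdeal_iff_eq_primesEquiv_symm v hp

/-- **An integer Weierstrass model has good reduction at every finite place whose prime does not divide `Δ`** (the equation is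
`v`-integral with unit discriminant; Silverman AEC VII.5 Prop. 5.1(a), VIII.1 Rem. 1.3). [cite: SilvermanAEC2009, VII.5 Prop. 5.1(a)] -/
theorem hasGoodReductionAt_baseChange_int_of_not_dvd (E : WeierstrassCurve ℤ) (v : HeightOneSpectrum (𝓞 ℚ))
    (hv : ¬ (natGenerator v : ℤ) ∣ E.Δ) : (E.baseChange ℚ).HasGoodReductionAt v := by
  have hE : E.baseChange ℚ = E.map (Int.castRingHom ℚ) := rfl
  obtain ⟨h₁, h₂, h₃, h₄, h₆⟩ := WeierstrassCurve.valuation_map_a_le_one v E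
  rw [hE]
  refine (E.map (Int.castRingHom ℚ)).hasGoodReductionAt_of_valuation_le_one_of_valuation_Δ_eq_one v
    h₁ h₂ h₃ h₄ h₆ ?_
  rw [map_Δ, eq_intCast]
  exact Literature.NumberTheory.GaloisRepresentations.Rat.valuation_intCast_eq_one v hv

end VisiblePlaces

open VisiblePlaces

/-! ## §2 D1 ∕ V1: `S = {v₃, v₅, v₁₁, v₄₇, v₁₉₇}` (Finset literal) -/

/-- Outside `{v₃, v₅, v₁₁, v₄₇, v₁₉₇}` the prime below `v` is none of `3, 5, 11, 47, 197`. [folklore] -/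
theorem natGenerator_ne_of_not_mem_placesD1 {v : HeightOneSpectrum (𝓞 ℚ)} (hv : v ∉ ({(primesEquiv (R := 𝓞 ℚ)).symm ⟨3, by norm_num⟩, (primesEquiv (R := 𝓞 ℚ)).symm ⟨5, by norm_num⟩,
        (primesEquiv (R := 𝓞 ℚ)).symm ⟨11, by norm_num⟩, (primesEquiv (R := 𝓞 ℚ)).symm ⟨47, by norm_num⟩,
        (primesEquiv (R := 𝓞 ℚ)).symm ⟨197, by norm_num⟩} : Finset (HeightOneSpectrum (𝓞 ℚ)))) :
    natGenerator v ≠ 3 ∧ natGenerator v ≠ 5 ∧ natGenerator v ≠ 11 ∧ natGenerator v ≠ 47 ∧ natGenerator v ≠ 197 := by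
  simp only [Finset.mem_insert, Finset.mem_singleton, not_or] at hv
  obtain ⟨h3, h5, h11, h47, h197⟩ := hv
  exact ⟨fun h ↦ h3 (eq_placeAbove_of_natGenerator_eq (by norm_num) h),
    fun h ↦ h5 (eq_placeAbove_of_natGenerator_eq (by norm_num) h),
    fun h ↦ h11 (eq_placeAbove_of_natGenerator_eq (by norm_num) h),
    fun h ↦ h47 (eq_placeAbove_of_natGenerator_eq (by norm_num) h),
    fun h ↦ h197 (eq_placeAbove_of_natGenerator_eq (by norm_num) h)⟩

/-- **Outside `{v₃, v₅, v₁₁, v₄₇, v₁₉₇}` both D1 and V1 have good reduction and `v ∤ 5`** — the hypothesis `hS` of the D1 rung, PROVED: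
`Δ(D1) = 5³·11⁶·47·197⁶` and `Δ(V1) = −3¹⁰·5²·11¹¹·47·197⁶` have no prime factor outside `{3,5,11,47,197}`.
[cite: SilvermanAEC2009, VII.5 Prop. 5.1(a)] -/
theorem good_outside_placesD1 (v : HeightOneSpectrum (𝓞 ℚ)) (hv : v ∉ ({(primesEquiv (R := 𝓞 ℚ)).symm ⟨3, by norm_num⟩, (primesEquiv (R := 𝓞 ℚ)).symm ⟨5, by norm_num⟩,
        (primesEquiv (R := 𝓞 ℚ)).symm ⟨11, by norm_num⟩, (primesEquiv (R := 𝓞 ℚ)).symm ⟨47, by norm_num⟩,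
        (primesEquiv (R := 𝓞 ℚ)).symm ⟨197, by norm_num⟩} : Finset (HeightOneSpectrum (𝓞 ℚ)))) :
    ((⟨1, 0, 0, -23577276, -23098167619⟩ : WeierstrassCurve ℤ).baseChange ℚ).HasGoodReductionAt v ∧
    ((⟨1, 1, 1, -17985352701, 1881572323801248⟩ : WeierstrassCurve ℤ).baseChange ℚ).HasGoodReductionAt v ∧
    ((5 : ℕ) : 𝓞 ℚ) ∉ v.asIdeal := by
  obtain ⟨h3, h5, h11, h47, h197⟩ := natGenerator_ne_of_not_mem_placesD1 hv
  have hp : (natGenerator v).Prime := prime_natGenerator v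
  -- a prime dividing one of the two discriminants is one of 3, 5, 11, 47, 197
  have key : ∀ n : ℕ, n ∣ 3 ^ 10 * 5 ^ 3 * 11 ^ 11 * 47 * 197 ^ 6 → n.Prime →
      n = 3 ∨ n = 5 ∨ n = 11 ∨ n = 47 ∨ n = 197 := by
    intro n hn hn'
    rcases (Nat.Prime.dvd_mul hn').mp hn with h | h
    · rcases (Nat.Prime.dvd_mul hn').mp h with h | h
      · rcases (Nat.Prime.dvd_mul hn').mp h with h | h
        · rcases (Nat.Prime.dvd_mul hn').mp h with h | h
          · exact Or.inl ((Nat.prime_dvd_prime_iff_eq hn' (by norm_num)).mp (hn'.dvd_of_dvd_pow h))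
          · exact Or.inr (Or.inl ((Nat.prime_dvd_prime_iff_eq hn' (by norm_num)).mp (hn'.dvd_of_dvd_pow h)))
        · exact Or.inr (Or.inr (Or.inl ((Nat.prime_dvd_prime_iff_eq hn' (by norm_num)).mp (hn'.dvd_of_dvd_pow h))))
      · exact Or.inr (Or.inr (Or.inr (Or.inl ((Nat.prime_dvd_prime_iff_eq hn' (by norm_num)).mp h))))
    · exact Or.inr (Or.inr (Or.inr (Or.inr ((Nat.prime_dvd_prime_iff_eq hn' (by norm_num)).mp (hn'.dvd_of_dvd_pow h)))))
  have hnot : ¬ (natGenerator v ∣ 3 ^ 10 * 5 ^ 3 * 11 ^ 11 * 47 * 197 ^ 6) := by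
    intro h
    rcases key _ h hp with h | h | h | h | h
    · exact h3 h
    · exact h5 h
    · exact h11 h
    · exact h47 h
    · exact h197 h
  refine ⟨hasGoodReductionAt_baseChange_int_of_not_dvd _ v ?_, hasGoodReductionAt_baseChange_int_of_not_dvd _ v ?_, ?_⟩
  · rw [MD1_Δ]
    intro h
    apply hnot
    have h' : (natGenerator v : ℤ) ∣ ((3 ^ 10 * 5 ^ 3 * 11 ^ 11 * 47 * 197 ^ 6 : ℕ) : ℤ) :=
      h.trans (by norm_num)
    exact_mod_cast h'
  · rw [MV1_Δ]
    intro h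
    apply hnot
    have h' : (natGenerator v : ℤ) ∣ ((3 ^ 10 * 5 ^ 3 * 11 ^ 11 * 47 * 197 ^ 6 : ℕ) : ℤ) :=
      (Int.dvd_neg.mpr h).trans (by norm_num)
    exact_mod_cast h'
  · rw [Nat.cast_ofNat, show (5 : 𝓞 ℚ) = ((5 : ℕ) : 𝓞 ℚ) by norm_num,
      natCast_mem_asIdeal_iff_eq_placeAbove v (by norm_num : (5 : ℕ).Prime)]
    intro h
    exact h5 (by rw [h, natGenerator_placeAbove])

/-- **RUNG at `(D1, 5)` with explicit places**: `P2OpenInputOnTreeAt D1 5` from the published facts and the visible-`Ш` data, the set of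
bad places being the kernel object the literal `{v₃, v₅, v₁₁, v₄₇, v₁₉₇}` (`v_ℓ = primesEquiv.symm ℓ`) with good reduction outside it PROVED (`good_outside_placesD1`);
the local kinds AT the five places stay data (`hplaces`). [cite: CremonaMazur2000, §3 and Table 1] [cite: AgasheStein2002, Thm. 3.1]
[cite: JetchevSkinnerWan2017, Thm. 3.3.1, §7.4.1] [cite: SilvermanAEC2009, VII.5 Prop. 5.1(a), X.4.14] -/
theorem openInput_D1_of_visibleSha_places_of_thm331Mult
    [((⟨1, 0, 0, -23577276, -23098167619⟩ : WeierstrassCurve ℤ).baseChange ℚ).IsElliptic]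
    [((⟨1, 0, 0, -23577276, -23098167619⟩ : WeierstrassCurve ℤ).baseChange ℚ).IsGloballyMinimal]
    [((⟨1, 1, 1, -17985352701, 1881572323801248⟩ : WeierstrassCurve ℤ).baseChange ℚ).IsElliptic]
    (h331 : JetchevSkinnerWan2017.thm331_anticyclotomicControl_mult)
    (hGZ : ∀ (N : ℕ) [NeZero N] (W : WeierstrassCurve ℚ) (K : Type) [Field K] [NumberField K],
      gross_zagier N W K)
    (hKo : ∀ (N : ℕ) [NeZero N] (W : WeierstrassCurve ℚ) (K : Type) [Field K] [NumberField K],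
      kolyvagin N W K)
    (hSk : Skinner2016.thmC_padicValRat_bsd_rank_zero)
    (hGZK : rank_eq_analyticRank_of_analyticRank_le_one) (hmod : hasEntireLFunction_rat)
    (hCT : exists_casselsTate_pairing (K := ℚ))
    (hU : Silverman1994_thmV53_tateUniformisation.{0})
    (hU2 : Silverman1994_thmV53_corV54_tateUniformisation.{0})
    (hr : ((⟨1, 0, 0, -23577276, -23098167619⟩ : WeierstrassCurve ℤ).baseChange ℚ).analyticRank = 1)
    {q : ℚ} (hq : shaAn ((⟨1, 0, 0, -23577276, -23098167619⟩ : WeierstrassCurve ℤ).baseChange ℚ) = (q : ℂ))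
    (hv : padicValRat 5 q ≤ 2)
    (θ : geomTorsion ((⟨1, 1, 1, -17985352701, 1881572323801248⟩ : WeierstrassCurve ℤ).baseChange ℚ) ((5 : ℕ) : ℤ) ≃+
      geomTorsion ((⟨1, 0, 0, -23577276, -23098167619⟩ : WeierstrassCurve ℤ).baseChange ℚ) ((5 : ℕ) : ℤ))
    (hθ : ∀ (σ : Field.absoluteGaloisGroup ℚ) (P : geomTorsion
      ((⟨1, 1, 1, -17985352701, 1881572323801248⟩ : WeierstrassCurve ℤ).baseChange ℚ) ((5 : ℕ) : ℤ)), θ (σ • P) = σ • θ P)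
    (hrank : 2 ≤ ((⟨1, 1, 1, -17985352701, 1881572323801248⟩ : WeierstrassCurve ℤ).baseChange ℚ).mordellWeilRank)
    (hplaces : ∀ v ∈ ({(primesEquiv (R := 𝓞 ℚ)).symm ⟨3, by norm_num⟩, (primesEquiv (R := 𝓞 ℚ)).symm ⟨5, by norm_num⟩,
        (primesEquiv (R := 𝓞 ℚ)).symm ⟨11, by norm_num⟩, (primesEquiv (R := 𝓞 ℚ)).symm ⟨47, by norm_num⟩,
        (primesEquiv (R := 𝓞 ℚ)).symm ⟨197, by norm_num⟩} : Finset (HeightOneSpectrum (𝓞 ℚ))),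
      (((5 : ℕ) : 𝓞 ℚ) ∉ v.asIdeal ∧ Nat.card (nsmulAddMonoidHom 5 :
          ((((⟨1, 1, 1, -17985352701, 1881572323801248⟩ : WeierstrassCurve ℤ).baseChange ℚ)).baseChange
            (v.adicCompletion ℚ)).toAffine.Point →+ _).ker = 1) ∨
      (((⟨1, 0, 0, -23577276, -23098167619⟩ : WeierstrassCurve ℤ).baseChange ℚ).HasSplitMultiplicativeReductionAt v ∧
        ((⟨1, 1, 1, -17985352701, 1881572323801248⟩ : WeierstrassCurve ℤ).baseChange ℚ).HasSplitMultiplicativeReductionAt v ∧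
        Nat.card (nsmulAddMonoidHom 5 :
          ((((⟨1, 0, 0, -23577276, -23098167619⟩ : WeierstrassCurve ℤ).baseChange ℚ)).baseChange
            (v.adicCompletion ℚ)).toAffine.Point →+ _).ker ≤ 5) ∨
      (((⟨1, 0, 0, -23577276, -23098167619⟩ : WeierstrassCurve ℤ).baseChange ℚ).HasMultiplicativeReductionAt v ∧
        ((⟨1, 1, 1, -17985352701, 1881572323801248⟩ : WeierstrassCurve ℤ).baseChange ℚ).HasMultiplicativeReductionAt v ∧
        (∃ r : v.adicCompletion ℚ, algebraMap ℚ (v.adicCompletion ℚ)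
            (-(((⟨1, 0, 0, -23577276, -23098167619⟩ : WeierstrassCurve ℤ).baseChange ℚ).c₄ /
               ((⟨1, 0, 0, -23577276, -23098167619⟩ : WeierstrassCurve ℤ).baseChange ℚ).c₆)) =
          r ^ 2 * algebraMap ℚ (v.adicCompletion ℚ)
            (-(((⟨1, 1, 1, -17985352701, 1881572323801248⟩ : WeierstrassCurve ℤ).baseChange ℚ).c₄ /
               ((⟨1, 1, 1, -17985352701, 1881572323801248⟩ : WeierstrassCurve ℤ).baseChange ℚ).c₆))) ∧
        (∀ ζ : v.adicCompletion ℚ, ζ ^ 5 = 1 → ζ = 1))) :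
    Summit.BirchSwinnertonDyer.Rank1Residual.X11b.P2OpenInputOnTreeAt
      ((⟨1, 0, 0, -23577276, -23098167619⟩ : WeierstrassCurve ℤ).baseChange ℚ) 5 :=
  openInput_D1_of_visibleSha_of_thm331Mult h331 hGZ hKo hSk hGZK hmod hCT hU hU2 hr hq hv θ hθ hrank _
    good_outside_placesD1 hplaces

/-! ## §3 D2 ∕ V2: `S = {v₂, v₃, v₅, v₁₉, v₁₂₇, v₃₅₉}`, paid place `v₁₉` -/

/-- Outside `{v₂, v₃, v₅, v₁₉, v₁₂₇, v₃₅₉}` the prime below `v` is none of `2, 3, 5, 19, 127, 359`. [folklore] -/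
theorem natGenerator_ne_of_not_mem_placesD2 {v : HeightOneSpectrum (𝓞 ℚ)} (hv : v ∉ ({(primesEquiv (R := 𝓞 ℚ)).symm ⟨2, by norm_num⟩, (primesEquiv (R := 𝓞 ℚ)).symm ⟨3, by norm_num⟩,
        (primesEquiv (R := 𝓞 ℚ)).symm ⟨5, by norm_num⟩, (primesEquiv (R := 𝓞 ℚ)).symm ⟨19, by norm_num⟩,
        (primesEquiv (R := 𝓞 ℚ)).symm ⟨127, by norm_num⟩, (primesEquiv (R := 𝓞 ℚ)).symm ⟨359, by norm_num⟩} : Finset (HeightOneSpectrum (𝓞 ℚ)))) :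
    natGenerator v ≠ 2 ∧ natGenerator v ≠ 3 ∧ natGenerator v ≠ 5 ∧ natGenerator v ≠ 19 ∧ natGenerator v ≠ 127 ∧
      natGenerator v ≠ 359 := by
  simp only [Finset.mem_insert, Finset.mem_singleton, not_or] at hv
  obtain ⟨h2, h3, h5, h19, h127, h359⟩ := hv
  exact ⟨fun h ↦ h2 (eq_placeAbove_of_natGenerator_eq (by norm_num) h),
    fun h ↦ h3 (eq_placeAbove_of_natGenerator_eq (by norm_num) h),
    fun h ↦ h5 (eq_placeAbove_of_natGenerator_eq (by norm_num) h),
    fun h ↦ h19 (eq_placeAbove_of_natGenerator_eq (by norm_num) h),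
    fun h ↦ h127 (eq_placeAbove_of_natGenerator_eq (by norm_num) h),
    fun h ↦ h359 (eq_placeAbove_of_natGenerator_eq (by norm_num) h)⟩

/-- **Outside `{v₂, v₃, v₅, v₁₉, v₁₂₇, v₃₅₉}` both D2 and V2 have good reduction and `v ∤ 5`** (`Δ(D2) = −2⁶·5·127·359⁶`, `Δ(V2) = 2²³·3⁵·5²·19⁵·127³·359⁶`).
[cite: SilvermanAEC2009, VII.5 Prop. 5.1(a)] -/
theorem good_outside_placesD2 (v : HeightOneSpectrum (𝓞 ℚ)) (hv : v ∉ ({(primesEquiv (R := 𝓞 ℚ)).symm ⟨2, by norm_num⟩, (primesEquiv (R := 𝓞 ℚ)).symm ⟨3, by norm_num⟩,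
        (primesEquiv (R := 𝓞 ℚ)).symm ⟨5, by norm_num⟩, (primesEquiv (R := 𝓞 ℚ)).symm ⟨19, by norm_num⟩,
        (primesEquiv (R := 𝓞 ℚ)).symm ⟨127, by norm_num⟩, (primesEquiv (R := 𝓞 ℚ)).symm ⟨359, by norm_num⟩} : Finset (HeightOneSpectrum (𝓞 ℚ)))) :
    ((⟨0, 1, 0, -5327081, -4755412951⟩ : WeierstrassCurve ℤ).baseChange ℚ).HasGoodReductionAt v ∧
    ((⟨0, -1, 0, -2109441896001, 331270051938574401⟩ : WeierstrassCurve ℤ).baseChange ℚ).HasGoodReductionAt v ∧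
    ((5 : ℕ) : 𝓞 ℚ) ∉ v.asIdeal := by
  obtain ⟨h2, h3, h5, h19, h127, h359⟩ := natGenerator_ne_of_not_mem_placesD2 hv
  have hp : (natGenerator v).Prime := prime_natGenerator v
  have key : ∀ n : ℕ, n ∣ 2 ^ 23 * 3 ^ 5 * 5 ^ 2 * 19 ^ 5 * 127 ^ 3 * 359 ^ 6 → n.Prime →
      n = 2 ∨ n = 3 ∨ n = 5 ∨ n = 19 ∨ n = 127 ∨ n = 359 := by
    intro n hn hn'
    rcases (Nat.Prime.dvd_mul hn').mp hn with h | h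
    · rcases (Nat.Prime.dvd_mul hn').mp h with h | h
      · rcases (Nat.Prime.dvd_mul hn').mp h with h | h
        · rcases (Nat.Prime.dvd_mul hn').mp h with h | h
          · rcases (Nat.Prime.dvd_mul hn').mp h with h | h
            · exact Or.inl ((Nat.prime_dvd_prime_iff_eq hn' (by norm_num)).mp (hn'.dvd_of_dvd_pow h))
            · exact Or.inr (Or.inl ((Nat.prime_dvd_prime_iff_eq hn' (by norm_num)).mp (hn'.dvd_of_dvd_pow h)))
          · exact Or.inr (Or.inr (Or.inl ((Nat.prime_dvd_prime_iff_eq hn' (by norm_num)).mp (hn'.dvd_of_dvd_pow h))))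
        · exact Or.inr (Or.inr (Or.inr (Or.inl ((Nat.prime_dvd_prime_iff_eq hn' (by norm_num)).mp (hn'.dvd_of_dvd_pow h)))))
      · exact Or.inr (Or.inr (Or.inr (Or.inr (Or.inl ((Nat.prime_dvd_prime_iff_eq hn' (by norm_num)).mp
          (hn'.dvd_of_dvd_pow h))))))
    · exact Or.inr (Or.inr (Or.inr (Or.inr (Or.inr ((Nat.prime_dvd_prime_iff_eq hn' (by norm_num)).mp
        (hn'.dvd_of_dvd_pow h))))))
  have hnot : ¬ (natGenerator v ∣ 2 ^ 23 * 3 ^ 5 * 5 ^ 2 * 19 ^ 5 * 127 ^ 3 * 359 ^ 6) := by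
    intro h
    rcases key _ h hp with h | h | h | h | h | h
    · exact h2 h
    · exact h3 h
    · exact h5 h
    · exact h19 h
    · exact h127 h
    · exact h359 h
  refine ⟨hasGoodReductionAt_baseChange_int_of_not_dvd _ v ?_, hasGoodReductionAt_baseChange_int_of_not_dvd _ v ?_, ?_⟩
  · rw [MD2_Δ]
    intro h
    apply hnot
    have h' : (natGenerator v : ℤ) ∣ ((2 ^ 23 * 3 ^ 5 * 5 ^ 2 * 19 ^ 5 * 127 ^ 3 * 359 ^ 6 : ℕ) : ℤ) :=
      (Int.dvd_neg.mpr h).trans (by norm_num)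
    exact_mod_cast h'
  · rw [MV2_Δ]
    intro h
    apply hnot
    have h' : (natGenerator v : ℤ) ∣ ((2 ^ 23 * 3 ^ 5 * 5 ^ 2 * 19 ^ 5 * 127 ^ 3 * 359 ^ 6 : ℕ) : ℤ) :=
      h.trans (by norm_num)
    exact_mod_cast h'
  · rw [Nat.cast_ofNat, show (5 : 𝓞 ℚ) = ((5 : ℕ) : 𝓞 ℚ) by norm_num,
      natCast_mem_asIdeal_iff_eq_placeAbove v (by norm_num : (5 : ℕ).Prime)]
    intro h
    exact h5 (by rw [h, natGenerator_placeAbove])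

/-- The paid place `v₁₉` lies in `{v₂, v₃, v₅, v₁₉, v₁₂₇, v₃₅₉}`. [folklore] -/
theorem placeAbove_nineteen_mem_placesD2 : (primesEquiv (R := 𝓞 ℚ)).symm ⟨19, by norm_num⟩ ∈ ({(primesEquiv (R := 𝓞 ℚ)).symm ⟨2, by norm_num⟩, (primesEquiv (R := 𝓞 ℚ)).symm ⟨3, by norm_num⟩,
        (primesEquiv (R := 𝓞 ℚ)).symm ⟨5, by norm_num⟩, (primesEquiv (R := 𝓞 ℚ)).symm ⟨19, by norm_num⟩,
        (primesEquiv (R := 𝓞 ℚ)).symm ⟨127, by norm_num⟩, (primesEquiv (R := 𝓞 ℚ)).symm ⟨359, by norm_num⟩} : Finset (HeightOneSpectrum (𝓞 ℚ))) := by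
  simp

/-- `5 ∉ v₁₉`. [folklore] -/
theorem five_not_mem_placeAbove_nineteen :
    ((5 : ℕ) : 𝓞 ℚ) ∉ ((primesEquiv (R := 𝓞 ℚ)).symm ⟨19, (by norm_num : (19 : ℕ).Prime)⟩).asIdeal := by
  rw [Nat.cast_ofNat, show (5 : 𝓞 ℚ) = ((5 : ℕ) : 𝓞 ℚ) by norm_num,
    natCast_mem_asIdeal_iff_eq_placeAbove _ (by norm_num : (5 : ℕ).Prime)]
  intro h
  have := congrArg natGenerator h
  rw [natGenerator_placeAbove, natGenerator_placeAbove] at this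
  norm_num at this

/-- **RUNG at `(D2, 5)` with explicit places**: `P2OpenInputOnTreeAt D2 5` from the published facts and the visible-`Ш` data; the set of
bad places is the kernel object the literal `{v₂, v₃, v₅, v₁₉, v₁₂₇, v₃₅₉}` with good reduction outside it PROVED, and the paid place is
`v₁₉ ∈ S` with `5 ∉ v₁₉` PROVED; the local kinds at the other five places and `#V2(ℚ₁₉)[5] ≤ 5` stay data.
[cite: CremonaMazur2000, §3 and Table 1] [cite: AgasheStein2002, Thm. 3.1 and §3.5] [cite: JetchevSkinnerWan2017, Thm. 3.3.1, §7.4.1]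
[cite: SilvermanAEC2009, VII.5 Prop. 5.1(a), X.4.14] -/
theorem openInput_D2_of_visibleSha_places_of_thm331Mult
    [((⟨0, 1, 0, -5327081, -4755412951⟩ : WeierstrassCurve ℤ).baseChange ℚ).IsElliptic]
    [((⟨0, 1, 0, -5327081, -4755412951⟩ : WeierstrassCurve ℤ).baseChange ℚ).IsGloballyMinimal]
    [((⟨0, -1, 0, -2109441896001, 331270051938574401⟩ : WeierstrassCurve ℤ).baseChange ℚ).IsElliptic]
    (h331 : JetchevSkinnerWan2017.thm331_anticyclotomicControl_mult)
    (hGZ : ∀ (N : ℕ) [NeZero N] (W : WeierstrassCurve ℚ) (K : Type) [Field K] [NumberField K],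
      gross_zagier N W K)
    (hKo : ∀ (N : ℕ) [NeZero N] (W : WeierstrassCurve ℚ) (K : Type) [Field K] [NumberField K],
      kolyvagin N W K)
    (hSk : Skinner2016.thmC_padicValRat_bsd_rank_zero)
    (hGZK : rank_eq_analyticRank_of_analyticRank_le_one) (hmod : hasEntireLFunction_rat)
    (hCT : exists_casselsTate_pairing (K := ℚ))
    (hU : Silverman1994_thmV53_tateUniformisation.{0})
    (hU2 : Silverman1994_thmV53_corV54_tateUniformisation.{0})
    (hr : ((⟨0, 1, 0, -5327081, -4755412951⟩ : WeierstrassCurve ℤ).baseChange ℚ).analyticRank = 1)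
    {q : ℚ} (hq : shaAn ((⟨0, 1, 0, -5327081, -4755412951⟩ : WeierstrassCurve ℤ).baseChange ℚ) = (q : ℂ))
    (hv : padicValRat 5 q ≤ 2)
    (θ : geomTorsion ((⟨0, -1, 0, -2109441896001, 331270051938574401⟩ : WeierstrassCurve ℤ).baseChange ℚ) ((5 : ℕ) : ℤ) ≃+
      geomTorsion ((⟨0, 1, 0, -5327081, -4755412951⟩ : WeierstrassCurve ℤ).baseChange ℚ) ((5 : ℕ) : ℤ))
    (hθ : ∀ (σ : Field.absoluteGaloisGroup ℚ) (P : geomTorsion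
      ((⟨0, -1, 0, -2109441896001, 331270051938574401⟩ : WeierstrassCurve ℤ).baseChange ℚ) ((5 : ℕ) : ℤ)), θ (σ • P) = σ • θ P)
    (hrank : 3 ≤ ((⟨0, -1, 0, -2109441896001, 331270051938574401⟩ : WeierstrassCurve ℤ).baseChange ℚ).mordellWeilRank)
    (hwtors : Nat.card (nsmulAddMonoidHom 5 :
      ((((⟨0, -1, 0, -2109441896001, 331270051938574401⟩ : WeierstrassCurve ℤ).baseChange ℚ)).baseChange
        (((primesEquiv (R := 𝓞 ℚ)).symm ⟨19, (by norm_num : (19 : ℕ).Prime)⟩).adicCompletion ℚ)).toAffine.Point →+ _).ker ≤ 5)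
    (hplaces : ∀ v ∈ ({(primesEquiv (R := 𝓞 ℚ)).symm ⟨2, by norm_num⟩, (primesEquiv (R := 𝓞 ℚ)).symm ⟨3, by norm_num⟩,
        (primesEquiv (R := 𝓞 ℚ)).symm ⟨5, by norm_num⟩, (primesEquiv (R := 𝓞 ℚ)).symm ⟨19, by norm_num⟩,
        (primesEquiv (R := 𝓞 ℚ)).symm ⟨127, by norm_num⟩, (primesEquiv (R := 𝓞 ℚ)).symm ⟨359, by norm_num⟩} : Finset (HeightOneSpectrum (𝓞 ℚ))),
      v ≠ (primesEquiv (R := 𝓞 ℚ)).symm ⟨19, by norm_num⟩ →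
      (((5 : ℕ) : 𝓞 ℚ) ∉ v.asIdeal ∧ Nat.card (nsmulAddMonoidHom 5 :
          ((((⟨0, -1, 0, -2109441896001, 331270051938574401⟩ : WeierstrassCurve ℤ).baseChange ℚ)).baseChange
            (v.adicCompletion ℚ)).toAffine.Point →+ _).ker = 1) ∨
      (((⟨0, 1, 0, -5327081, -4755412951⟩ : WeierstrassCurve ℤ).baseChange ℚ).HasSplitMultiplicativeReductionAt v ∧
        ((⟨0, -1, 0, -2109441896001, 331270051938574401⟩ : WeierstrassCurve ℤ).baseChange ℚ).HasSplitMultiplicativeReductionAt v ∧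
        Nat.card (nsmulAddMonoidHom 5 :
          ((((⟨0, 1, 0, -5327081, -4755412951⟩ : WeierstrassCurve ℤ).baseChange ℚ)).baseChange
            (v.adicCompletion ℚ)).toAffine.Point →+ _).ker ≤ 5) ∨
      (((⟨0, 1, 0, -5327081, -4755412951⟩ : WeierstrassCurve ℤ).baseChange ℚ).HasMultiplicativeReductionAt v ∧
        ((⟨0, -1, 0, -2109441896001, 331270051938574401⟩ : WeierstrassCurve ℤ).baseChange ℚ).HasMultiplicativeReductionAt v ∧
        (∃ r : v.adicCompletion ℚ, algebraMap ℚ (v.adicCompletion ℚ)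
            (-(((⟨0, 1, 0, -5327081, -4755412951⟩ : WeierstrassCurve ℤ).baseChange ℚ).c₄ /
               ((⟨0, 1, 0, -5327081, -4755412951⟩ : WeierstrassCurve ℤ).baseChange ℚ).c₆)) =
          r ^ 2 * algebraMap ℚ (v.adicCompletion ℚ)
            (-(((⟨0, -1, 0, -2109441896001, 331270051938574401⟩ : WeierstrassCurve ℤ).baseChange ℚ).c₄ /
               ((⟨0, -1, 0, -2109441896001, 331270051938574401⟩ : WeierstrassCurve ℤ).baseChange ℚ).c₆))) ∧
        (∀ ζ : v.adicCompletion ℚ, ζ ^ 5 = 1 → ζ = 1))) :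
    Summit.BirchSwinnertonDyer.Rank1Residual.X11b.P2OpenInputOnTreeAt
      ((⟨0, 1, 0, -5327081, -4755412951⟩ : WeierstrassCurve ℤ).baseChange ℚ) 5 :=
  openInput_D2_of_visibleSha_of_thm331Mult h331 hGZ hKo hSk hGZK hmod hCT hU hU2 hr hq hv θ hθ hrank _
    ((primesEquiv (R := 𝓞 ℚ)).symm ⟨19, by norm_num⟩) placeAbove_nineteen_mem_placesD2 five_not_mem_placeAbove_nineteen hwtors
    good_outside_placesD2 hplaces

end Summit.BirchSwinnertonDyer.BirchSwinnertonDyer.Theorems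

end
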